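import Summits.ABC.IUTFork.Repair.RHReqsideWeightLawsThreshold
import HarnessLib

/-!
# ROUND-3 AXIS D2 «HEIGHT SCALING», object class «κ′ WEIGHT LAWS» (axis-B knob k1) — kernel face: EXTINCTION of the licence-only tier, the LAW-FREE
# netted-slack bracket (exponent `−1`), and the `l`-only constant ratios `den·S(l⋆)/dS_f(l⋆)`

abc-iut cell, rung LADDER-ABC:A2.RESCUE.H; seat abc-iut-rh2-w-1 g3 (KEY D2-EXP-6, 21-frontier 2026-08-27T11:38:40Z / 11:44:07Z, D-0127/D-0130); inputs of
record `plan/rescue/R-H/ROUND3/D0121-FINAL-1200Z.md` c9ab8e0bbc43dc94 item (1)(d)–(e) (credit conductor-type while the requirement grows with the height; «WINDOW =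
HEIGHT SCALING at fixed places and `l` (`m_q ↦ s·m_q`)») and Part (II) (axis-B table, knob k1); file of record `ROUND3/AXIS-D2/D2-EXP-6-kappa-laws-rh2-w-1.md`.
Typed currency = abc-iut-reqb-typ-1's k1-cell `ReqsideWeightLaws.Cell f den e m δ r_in r_out j` (p506542) with ledger form `(f(j) − den)·m ≤ den·(jδ + (j+1)G) + ρ_j`,
`G = r_in − r_out`, `0 ≤ ρ_j < den·e`, and the demand sums `demandSum f den n` (closed forms p506542 §2, `κ = 3/2` majorant p508156 §1). HEIGHT SCALING is the
substitution `m ↦ m'` (scaled pilot order; the engines take `m' = s·m_q`, `s` rational) — every statement below is about an ARBITRARY integer order, so it covers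
every `s`. PROOF-ONLY: no `def`, nothing re-typed. CONTENT (`n = l⋆`, `T(n) = n(n+1)/2`, `Π⁰ = Σ_{j≤n}(jδ + (j+1)G)`):
* §1 EXTINCTION (licence-only tier): `not_cell_of_budget_lt` — if `c(j−1) ≤ f(j) − den` (`j ≥ 2`) and `den(2δ + 3G + e) < c·m` then NO label `j ≥ 2` is a
  cell; instances for every `⌈j^{a/2}⌉` (`a ≥ 2`), print `j²` (`c = 3`; via the calibration also `¬HullCellδ`, the licence cell of record), `κ = 1` (a STEP next to
  the saturation law `cell_id_of_le`), shifts; `licensedDemand_eq_zero`: with `f(1) = den` the licensed demand is then `0` EXACTLY — extinct, not merely `→ 0`.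
* §2 NETTED SLACK: `den·margin_j = den(jδ + (j+1)G) + ρ_j − (f(j) − den)m` ⇒ `den·Π⁰ − m·dS_f ≤ den·Σ_j margin_j ≤ den·Π⁰ + n·den·e − m·dS_f` (law-free,
  height-free price sum `2Π⁰ = n(n+1)δ + n(n+3)G`); the place's netted inequality forces `m·dS_f ≤ den(Π⁰ + n e)` and is implied by `m·dS_f ≤ den·Π⁰`
  (crossing bracket, also weighted over places); the exact-slack kept amount `Σ_j min(demand_j, price_j) ≤ den(Π⁰ + n e)` for EVERY order (`keptSlack_le_budget`;
  sharp `C₁`-shape `keptSlack_le_budget_of_at_one`) — recovered fraction `≤ (law-free constant)/m`: EXPONENT `−1` in the height for every law.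
* §3 RATIOS (`l`-only): `3·dS_{j²} = (2n+5)·dS_j`, `(2n+5)·dS_{shift a} = (2n+5+6a)·dS_{j²}`, `dS_j ≤ dS_{3/2} ≤ dS_{j²} ≤ dS_{5/2}`,
  `(n−1)(2n+5)·dS_{3/2} ≤ 3(⌈√n⌉(n+1) − 2)·dS_{j²}`.
* §4 WORKED PLACE FREY `p = 7`, `l = 107` (`e 1605`, `m 210`, `δ 1604`, `r_in 268`, `r_out −4472`, `n = 53`; FINAL (1)(b) integers `Π⁰ = 9,329,484`,
  `Π⁰ + n·e = 9,414,549`, `M_print = 210·50,986 = 10,707,060`): print extinct from order `6345 = 30.2·m`, `κ = 1` from `19034 = 90.6·m`; the place is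
  netted-negative at the bed under print, netted-nonnegative under `κ = 1` up to order `6770 = 32.2·m`, negative from `6833`.
DOOR WORDS (rh3-tst-1 / rh3-tst-2, RULING R82 (c), adopted): no CLOSING door in the class (sentence scoped to `f(1) ≥ den`; `f(1) < den` = «affine ½» carries an
exponent-`0` NON-closing pilot credit of `l`-only size `(den − f(1))/dS⁺_f(l⋆) ≪ 1`); along the window diagonal `l ≍ √h` (analytic tower model — NOT the
fixed-`l` ray of these theorems) the exact-slack exponent is `−κ/2` for `⌈j^κ⌉`, reaching `0` only for demand laws bounded on `2 ≤ j ≤ l⋆` (`κ_eff = 0`) = the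
flattening FENCE of FINAL (1)(f), not a door. ENGINE NUMBERS (computed ≠ proved; `d2exp6_engine2.py` d0658cf9f50a3774 on the gen-6 integers cfbb74d50b6e709e,
concordant with REQB sheet v2.1 9a5c8c8e9f0d7ad2 on 16/16 law × bed crossings): exact-slack exponent `−1.000` on 8 laws × {FREY133, HEX79, FREY482}, constants
`c_f = c_print·den·S(l⋆)/dS_f(l⋆)` datum-wise to ≤ 0.9 % median; licence tier extinct below `1.7·10⁶` nats on every bed datum (content cut `4.7·10⁶`).
HONEST FRAMING: arithmetic about OUR typed k1-cell under HYPOTHETICAL parameter settings (REQB framing — not a claim that [EtTh]/[IUTchI–III] admit any law other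
than `j²`); nothing here asserts that abc is proved or refuted, or that [IUTchIII] Cor. 3.12 / [IUTchIV] Thm. 1.10 holds or fails at any datum, or takes a side on any
author; typed ≠ proved; computed ≠ proved. [claim: Mochizuki2012, status: disputed] for every IUT locution.
[cite: Mochizuki2012, IUTchIII Cor. 3.12 p. 173–174; IUTchIV Prop. 1.4 p. 13, Thm. 1.10 Step (v) p. 27–29]
-/

open Finset

namespace Summit.ABC.IUTFork.Repair.RH.ReqsideWeightLaws.HeightScaling

open Summit.ABC.IUTFork.Repair.RH.ReqsideWeightLaws Summit.ABC.IUTFork.Repair.RH.DiffPricedHull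

/-! ## §1. Extinction of the licence-only tier above a law-free order -/

/-- **EXTINCTION LEMMA.** If the law dominates a linear law of slope `c` above label `1` (`c(j−1) ≤ f(j) − den`, `j ≥ 2`) and the (scaled) pilot
order has passed the law-free budget, `den·(2δ + 3G + e) < c·m` (`G = r_in − r_out`; `m, δ, G ≥ 0`), then NO label `j ≥ 2` is a k1-cell:
`(f(j) − den)m ≥ c(j−1)m > (j−1)·den(2δ+3G+e) ≥ den(jδ + (j+1)G + e) > price_j`. [folklore] -/
theorem not_cell_of_budget_lt {f : ℕ → ℤ} {den e m δ rin rout c : ℤ} (hden : 0 < den) (he : 0 < e) (hm : 0 ≤ m) (hδ : 0 ≤ δ)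
    (hG : rout ≤ rin) (hf : ∀ j : ℕ, 2 ≤ j → c * ((j : ℤ) - 1) ≤ f j - den) (h : den * (2 * δ + 3 * (rin - rout) + e) < c * m)
    {j : ℕ} (hj : 2 ≤ j) : ¬ Cell f den e m δ rin rout j := by
  intro hc
  have h1 := linear_lt_of_cell hden he hc
  have hj' : (2 : ℤ) ≤ j := by exact_mod_cast hj
  have h2 : c * ((j : ℤ) - 1) * m ≤ (f j - den) * m := mul_le_mul_of_nonneg_right (hf j hj) hm
  have h3 : (j : ℤ) * δ + ((j : ℤ) + 1) * (rin - rout) + e ≤ ((j : ℤ) - 1) * (2 * δ + 3 * (rin - rout) + e) := by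
    nlinarith [mul_nonneg (sub_nonneg.mpr hj') hδ, mul_nonneg (sub_nonneg.mpr hj') (sub_nonneg.mpr hG),
      mul_nonneg (sub_nonneg.mpr hj') he.le]
  have h3' : den * ((j : ℤ) * δ + ((j : ℤ) + 1) * (rin - rout)) + den * e ≤ den * (((j : ℤ) - 1) * (2 * δ + 3 * (rin - rout) + e)) := by
    nlinarith
  have hj1 : (0 : ℤ) < (j : ℤ) - 1 := by linarith
  have h4 : ((j : ℤ) - 1) * (den * (2 * δ + 3 * (rin - rout) + e)) < ((j : ℤ) - 1) * (c * m) := mul_lt_mul_of_pos_left h hj1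
  linarith

/-- With `f(1) = den` (zero demand at label `1`: every `κ`-law and shift), a licensed label then carries ZERO demand: `Cell j ⟹ f(j) − den = 0`. [folklore] -/
theorem demand_eq_zero_of_cell {f : ℕ → ℤ} {den e m δ rin rout c : ℤ} (hden : 0 < den) (he : 0 < e) (hm : 0 ≤ m) (hδ : 0 ≤ δ)
    (hG : rout ≤ rin) (hf : ∀ j : ℕ, 2 ≤ j → c * ((j : ℤ) - 1) ≤ f j - den) (h : den * (2 * δ + 3 * (rin - rout) + e) < c * m)
    (hf1 : f 1 = den) {j : ℕ} (hj : 1 ≤ j) (hc : Cell f den e m δ rin rout j) : f j - den = 0 := by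
  by_cases h2 : 2 ≤ j
  · exact absurd hc (not_cell_of_budget_lt hden he hm hδ hG hf h h2)
  · obtain rfl : j = 1 := by omega
    rw [hf1, sub_self]

/-- **THE LICENCE-ONLY TIER IS EXTINCT**: past the budget, the place's licensed demand `Σ_{1 ≤ j ≤ n, Cell j} (f(j) − den)` is `0` EXACTLY (for every
number of labels `n`) — the kept mass of the licence-only tier vanishes identically, not merely asymptotically. [folklore] -/
theorem licensedDemand_eq_zero {f : ℕ → ℤ} {den e m δ rin rout c : ℤ} (hden : 0 < den) (he : 0 < e) (hm : 0 ≤ m) (hδ : 0 ≤ δ)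
    (hG : rout ≤ rin) (hf : ∀ j : ℕ, 2 ≤ j → c * ((j : ℤ) - 1) ≤ f j - den) (h : den * (2 * δ + 3 * (rin - rout) + e) < c * m)
    (hf1 : f 1 = den) (n : ℕ) [DecidablePred (Cell f den e m δ rin rout)] :
    ∑ j ∈ (Finset.Icc 1 n).filter (Cell f den e m δ rin rout), (f j - den) = 0 := by
  refine Finset.sum_eq_zero fun j hj => ?_
  rw [Finset.mem_filter, Finset.mem_Icc] at hj
  exact demand_eq_zero_of_cell hden he hm hδ hG hf h hf1 hj.1.1 hj.2

/-- Every `κ`-law `⌈j^{a/2}⌉` with `a ≥ 2` (`κ ≥ 1`) dominates the linear law: `j − 1 ≤ ⌈j^{a/2}⌉ − 1`. [folklore] -/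
theorem linear_le_lawPow_sub_one {a : ℕ} (ha : 2 ≤ a) {j : ℕ} (hj : 1 ≤ j) : 1 * ((j : ℤ) - 1) ≤ lawPow a j - 1 := by
  have h := lawPow_mono_exp hj ha
  rw [lawPow_two] at h
  linarith

/-- **EXTINCTION FOR EVERY `κ`-LAW** (`⌈j^{a/2}⌉`, `a ≥ 2`, `den = 1`): `2δ + 3G + e < m ⟹` no label `j ≥ 2` is a cell. [folklore] -/
theorem not_cell_lawPow_of_lt {a : ℕ} (ha : 2 ≤ a) {e m δ rin rout : ℤ} (he : 0 < e) (hm : 0 ≤ m) (hδ : 0 ≤ δ) (hG : rout ≤ rin)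
    (h : 2 * δ + 3 * (rin - rout) + e < m) {j : ℕ} (hj : 2 ≤ j) : ¬ Cell (lawPow a) 1 e m δ rin rout j :=
  not_cell_of_budget_lt one_pos he hm hδ hG (c := 1) (fun j hj => linear_le_lawPow_sub_one ha (by omega)) (by linarith) hj

/-- **EXTINCTION FOR PRINT `j²`** with the sharper slope `c = 3` (`j² − 1 = (j−1)(j+1) ≥ 3(j−1)`): `2δ + 3G + e < 3m ⟹` no label `j ≥ 2`. [folklore] -/
theorem not_cell_sq_of_lt {e m δ rin rout : ℤ} (he : 0 < e) (hm : 0 ≤ m) (hδ : 0 ≤ δ) (hG : rout ≤ rin)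
    (h : 2 * δ + 3 * (rin - rout) + e < 3 * m) {j : ℕ} (hj : 2 ≤ j) : ¬ Cell (fun j => (j : ℤ) ^ 2) 1 e m δ rin rout j :=
  not_cell_of_budget_lt one_pos he hm hδ hG (c := 3)
    (fun j hj => by
      have hj' : (2 : ℤ) ≤ j := by exact_mod_cast hj
      nlinarith [mul_nonneg (sub_nonneg.mpr hj') (sub_nonneg.mpr hj')])
    (by linarith) hj

/-- … and through the calibration `cell_sq_iff_hullCellδ`: the LICENCE CELL OF RECORD `HullCellδ` (SLICE row 4, `Σ₄`) is EMPTY above label `1` once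
`3m > 2δ + 3G + e` — the slice `j₀(w) = 1` at every such place, so the licence-only kept mass (labels weigh `j² − 1`) is `0`. [folklore] -/
theorem not_hullCellδ_of_lt {e m δ rin rout : ℤ} (he : 0 < e) (hm : 0 ≤ m) (hδ : 0 ≤ δ) (hG : rout ≤ rin)
    (h : 2 * δ + 3 * (rin - rout) + e < 3 * m) {j : ℕ} (hj : 2 ≤ j) : ¬ HullCellδ e m j δ rin rout := by
  rw [← cell_sq_iff_hullCellδ]
  exact not_cell_sq_of_lt he hm hδ hG h hj

/-- **`κ = 1` IS A STEP**: with `cell_id_of_le` (ALL labels while `m ≤ δ + G`) — NO label `≥ 2` once `m > 2δ + 3G + e`. [folklore] -/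
theorem not_cell_id_of_lt {e m δ rin rout : ℤ} (he : 0 < e) (hm : 0 ≤ m) (hδ : 0 ≤ δ) (hG : rout ≤ rin)
    (h : 2 * δ + 3 * (rin - rout) + e < m) {j : ℕ} (hj : 2 ≤ j) : ¬ Cell (fun j => (j : ℤ)) 1 e m δ rin rout j :=
  not_cell_of_budget_lt one_pos he hm hδ hG (c := 1) (fun j _ => by linarith) (by linarith) hj

/-- **EXTINCTION FOR THE SHIFTED LAWS** (`(j+a)² − (1+a)² + 1`, slope `c = 3 + 2a`): `2δ + 3G + e < (3+2a)m ⟹` no label `j ≥ 2`. [folklore] -/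
theorem not_cell_lawShift_of_lt (a : ℕ) {e m δ rin rout : ℤ} (he : 0 < e) (hm : 0 ≤ m) (hδ : 0 ≤ δ) (hG : rout ≤ rin)
    (h : 2 * δ + 3 * (rin - rout) + e < (3 + 2 * (a : ℤ)) * m) {j : ℕ} (hj : 2 ≤ j) : ¬ Cell (lawShift a) 1 e m δ rin rout j :=
  not_cell_of_budget_lt one_pos he hm hδ hG (c := 3 + 2 * (a : ℤ))
    (fun j hj => by
      have hj' : (2 : ℤ) ≤ j := by exact_mod_cast hj
      unfold lawShift
      nlinarith [mul_nonneg (sub_nonneg.mpr hj') (sub_nonneg.mpr hj'), (Nat.cast_nonneg a : (0 : ℤ) ≤ a)])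
    (by linarith) hj

/-! ## §2. The netted slack: law-free price, law-dependent demand — the exponent `−1` bracket -/

/-- **PER-CELL IDENTITY**: `den·margin_j = den(jδ + (j+1)G) + ρ_j − (f(j) − den)·m`, `margin_j := m − (j+1)r_out − e⌊(f(j)m − den(jδ + (j+1)r_in))/(den·e)⌋`
the exact slack of the k1-cell (`Cell ⟺ 0 ≤ margin_j`) and `ρ_j` the remainder `mod den·e`. [folklore] -/
theorem den_mul_margin_eq (f : ℕ → ℤ) (den e m δ rin rout : ℤ) (j : ℕ) :
    den * (m - ((j : ℤ) + 1) * rout - e * ((f j * m - den * ((j : ℤ) * δ + ((j : ℤ) + 1) * rin)) / (den * e))) =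
      den * ((j : ℤ) * δ + ((j : ℤ) + 1) * (rin - rout)) + (f j * m - den * ((j : ℤ) * δ + ((j : ℤ) + 1) * rin)) % (den * e)
        - (f j - den) * m := by
  have h := Int.mul_ediv_add_emod (f j * m - den * ((j : ℤ) * δ + ((j : ℤ) + 1) * rin)) (den * e)
  linear_combination -h

/-- **PER-CELL BRACKET** (`den, e > 0`): `den(jδ + (j+1)G) − (f(j) − den)m ≤ den·margin_j < den(jδ + (j+1)G) + den·e − (f(j) − den)m` — the price
is LAW-FREE and ORDER-FREE; only the demand `(f(j) − den)·m` carries the law and the height. [folklore] -/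
theorem den_mul_margin_bracket {den e : ℤ} (hden : 0 < den) (he : 0 < e) (f : ℕ → ℤ) (m δ rin rout : ℤ) (j : ℕ) :
    den * ((j : ℤ) * δ + ((j : ℤ) + 1) * (rin - rout)) - (f j - den) * m ≤
        den * (m - ((j : ℤ) + 1) * rout - e * ((f j * m - den * ((j : ℤ) * δ + ((j : ℤ) + 1) * rin)) / (den * e))) ∧
      den * (m - ((j : ℤ) + 1) * rout - e * ((f j * m - den * ((j : ℤ) * δ + ((j : ℤ) + 1) * rin)) / (den * e))) <
        den * ((j : ℤ) * δ + ((j : ℤ) + 1) * (rin - rout)) + den * e - (f j - den) * m := by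
  rw [den_mul_margin_eq]
  have h0 := Int.emod_nonneg (f j * m - den * ((j : ℤ) * δ + ((j : ℤ) + 1) * rin)) (mul_pos hden he).ne'
  have h1 := Int.emod_lt_of_pos (f j * m - den * ((j : ℤ) * δ + ((j : ℤ) + 1) * rin)) (mul_pos hden he)
  constructor <;> linarith

/-- **THE PRICE SUM IN CLOSED FORM** (law-free, order-free): `2·Σ_{j=1}^{n} (jδ + (j+1)G) = n(n+1)δ + n(n+3)G`. [folklore] -/
theorem two_mul_priceSum (δ G : ℤ) (n : ℕ) :
    2 * ∑ i ∈ Finset.range n, ((((i + 1 : ℕ) : ℤ)) * δ + (((i + 1 : ℕ) : ℤ) + 1) * G) = (n : ℤ) * (n + 1) * δ + (n : ℤ) * (n + 3) * G := by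
  induction n with
  | zero => simp
  | succ n ih => rw [Finset.sum_range_succ, mul_add, ih]; push_cast; ring

/-- **NETTED SLACK, LOWER END**: `den·Π⁰ − m·dS_f(n) ≤ den·Σ_{j≤n} margin_j` (`Π⁰ = Σ_{j≤n}(jδ + (j+1)G)`). [folklore] -/
theorem den_mul_netSlack_ge {den e : ℤ} (hden : 0 < den) (he : 0 < e) (f : ℕ → ℤ) (m δ rin rout : ℤ) (n : ℕ) :
    den * ∑ i ∈ Finset.range n, ((((i + 1 : ℕ) : ℤ)) * δ + (((i + 1 : ℕ) : ℤ) + 1) * (rin - rout)) - m * demandSum f den n ≤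
      den * ∑ i ∈ Finset.range n, (m - (((i + 1 : ℕ) : ℤ) + 1) * rout -
        e * ((f (i + 1) * m - den * ((((i + 1 : ℕ) : ℤ)) * δ + (((i + 1 : ℕ) : ℤ) + 1) * rin)) / (den * e))) := by
  unfold demandSum
  rw [Finset.mul_sum, Finset.mul_sum, Finset.mul_sum, ← Finset.sum_sub_distrib]
  refine Finset.sum_le_sum fun i _ => ?_
  have h := (den_mul_margin_bracket hden he f m δ rin rout (i + 1)).1
  linarith

/-- **NETTED SLACK, UPPER END**: `den·Σ_{j≤n} margin_j ≤ den·Π⁰ + n·den·e − m·dS_f(n)`. [folklore] -/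
theorem den_mul_netSlack_le {den e : ℤ} (hden : 0 < den) (he : 0 < e) (f : ℕ → ℤ) (m δ rin rout : ℤ) (n : ℕ) :
    den * ∑ i ∈ Finset.range n, (m - (((i + 1 : ℕ) : ℤ) + 1) * rout -
        e * ((f (i + 1) * m - den * ((((i + 1 : ℕ) : ℤ)) * δ + (((i + 1 : ℕ) : ℤ) + 1) * rin)) / (den * e))) ≤
      den * ∑ i ∈ Finset.range n, ((((i + 1 : ℕ) : ℤ)) * δ + (((i + 1 : ℕ) : ℤ) + 1) * (rin - rout)) + (n : ℤ) * (den * e)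
        - m * demandSum f den n := by
  unfold demandSum
  have hconst : (n : ℤ) * (den * e) = ∑ _i ∈ Finset.range n, den * e := by simp
  rw [Finset.mul_sum, Finset.mul_sum, Finset.mul_sum, hconst, ← Finset.sum_add_distrib, ← Finset.sum_sub_distrib]
  refine Finset.sum_le_sum fun i _ => ?_
  have h := (den_mul_margin_bracket hden he f m δ rin rout (i + 1)).2
  linarith

/-- **CROSSING, NECESSARY SIDE**: if the place's netted slack is `≥ 0` («C ≥ R» at the place, FINAL (1)(d)), then `m·dS_f(n) ≤ den·(Π⁰ + n·e)` — the
netted inequality FAILS for every order `m > den(Π⁰ + n·e)/dS_f(n)`; the bound is law-free except through `dS_f(n)/den`. [folklore] -/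
theorem demand_le_of_netSlack_nonneg {den e : ℤ} (hden : 0 < den) (he : 0 < e) (f : ℕ → ℤ) (m δ rin rout : ℤ) (n : ℕ)
    (h : 0 ≤ ∑ i ∈ Finset.range n, (m - (((i + 1 : ℕ) : ℤ) + 1) * rout -
        e * ((f (i + 1) * m - den * ((((i + 1 : ℕ) : ℤ)) * δ + (((i + 1 : ℕ) : ℤ) + 1) * rin)) / (den * e)))) :
    m * demandSum f den n ≤
      den * ∑ i ∈ Finset.range n, ((((i + 1 : ℕ) : ℤ)) * δ + (((i + 1 : ℕ) : ℤ) + 1) * (rin - rout)) + (n : ℤ) * (den * e) := by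
  have h1 := den_mul_netSlack_le hden he f m δ rin rout n
  have h2 : 0 ≤ den * ∑ i ∈ Finset.range n, (m - (((i + 1 : ℕ) : ℤ) + 1) * rout -
        e * ((f (i + 1) * m - den * ((((i + 1 : ℕ) : ℤ)) * δ + (((i + 1 : ℕ) : ℤ) + 1) * rin)) / (den * e))) :=
    mul_nonneg hden.le h
  linarith

/-- **CROSSING, SUFFICIENT SIDE**: `m·dS_f(n) ≤ den·Π⁰ ⟹` the place's netted slack is `≥ 0`. [folklore] -/
theorem netSlack_nonneg_of_demand_le {den e : ℤ} (hden : 0 < den) (he : 0 < e) (f : ℕ → ℤ) (m δ rin rout : ℤ) (n : ℕ)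
    (h : m * demandSum f den n ≤ den * ∑ i ∈ Finset.range n, ((((i + 1 : ℕ) : ℤ)) * δ + (((i + 1 : ℕ) : ℤ) + 1) * (rin - rout))) :
    0 ≤ ∑ i ∈ Finset.range n, (m - (((i + 1 : ℕ) : ℤ) + 1) * rout -
        e * ((f (i + 1) * m - den * ((((i + 1 : ℕ) : ℤ)) * δ + (((i + 1 : ℕ) : ℤ) + 1) * rin)) / (den * e))) := by
  have h1 := den_mul_netSlack_ge hden he f m δ rin rout n
  have h2 : 0 ≤ den * ∑ i ∈ Finset.range n, (m - (((i + 1 : ℕ) : ℤ) + 1) * rout -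
        e * ((f (i + 1) * m - den * ((((i + 1 : ℕ) : ℤ)) * δ + (((i + 1 : ℕ) : ℤ) + 1) * rin)) / (den * e))) := by linarith
  exact (mul_nonneg_iff_of_pos_left hden).mp h2

/-- **DATUM LEVEL (ACROSS PLACES)**: places `w ∈ S` with real weights `u_w ≥ 0` (the engines' `log p/e_w`), common law, `den`, `n`; if the WEIGHTED netted
slack is `≥ 0` then `(Σ_w u_w m_w)·dS_f(n) ≤ den·Σ_w u_w (Π⁰_w + n·e_w)` — the datum's netted crossing order sits below a LAW-FREE budget over
`dS_f(n)/den` (the «ratio law» `s×_f/s×_print ≈ den·S(l⋆)/dS_f(l⋆)` of the engines, up to the `n·e_w` floor term). [folklore] -/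
theorem weighted_demand_le_of_netSlack_nonneg {ι : Type*} (S : Finset ι) (u : ι → ℝ) (hu : ∀ w ∈ S, 0 ≤ u w) {den : ℤ} (hden : 0 < den)
    (f : ℕ → ℤ) (n : ℕ) (e m δ rin rout : ι → ℤ) (he : ∀ w ∈ S, 0 < e w)
    (h : 0 ≤ ∑ w ∈ S, u w * ((∑ i ∈ Finset.range n, (m w - (((i + 1 : ℕ) : ℤ) + 1) * rout w -
        e w * ((f (i + 1) * m w - den * ((((i + 1 : ℕ) : ℤ)) * δ w + (((i + 1 : ℕ) : ℤ) + 1) * rin w)) / (den * e w))) : ℤ) : ℝ)) :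
    (∑ w ∈ S, u w * (m w : ℝ)) * (demandSum f den n : ℝ) ≤
      (den : ℝ) * ∑ w ∈ S, u w * (((∑ i ∈ Finset.range n, ((((i + 1 : ℕ) : ℤ)) * δ w + (((i + 1 : ℕ) : ℤ) + 1) * (rin w - rout w)) : ℤ) : ℝ)
        + (n : ℝ) * (e w : ℝ)) := by
  have key : ∀ w ∈ S, u w * ((den : ℝ) * ((∑ i ∈ Finset.range n, (m w - (((i + 1 : ℕ) : ℤ) + 1) * rout w -
        e w * ((f (i + 1) * m w - den * ((((i + 1 : ℕ) : ℤ)) * δ w + (((i + 1 : ℕ) : ℤ) + 1) * rin w)) / (den * e w))) : ℤ) : ℝ)) ≤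
      u w * ((den : ℝ) * (((∑ i ∈ Finset.range n, ((((i + 1 : ℕ) : ℤ)) * δ w + (((i + 1 : ℕ) : ℤ) + 1) * (rin w - rout w)) : ℤ) : ℝ)
        + (n : ℝ) * (e w : ℝ)) - (m w : ℝ) * (demandSum f den n : ℝ)) := by
    intro w hw
    refine mul_le_mul_of_nonneg_left ?_ (hu w hw)
    have h1 := den_mul_netSlack_le hden (he w hw) f (m w) (δ w) (rin w) (rout w) n
    have h1' : ((den * ∑ i ∈ Finset.range n, (m w - (((i + 1 : ℕ) : ℤ) + 1) * rout w -
        e w * ((f (i + 1) * m w - den * ((((i + 1 : ℕ) : ℤ)) * δ w + (((i + 1 : ℕ) : ℤ) + 1) * rin w)) / (den * e w))) : ℤ) : ℝ) ≤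
        ((den * ∑ i ∈ Finset.range n, ((((i + 1 : ℕ) : ℤ)) * δ w + (((i + 1 : ℕ) : ℤ) + 1) * (rin w - rout w)) + (n : ℤ) * (den * e w)
          - m w * demandSum f den n : ℤ) : ℝ) := by exact_mod_cast h1
    push_cast at h1' ⊢
    linarith
  have hsum := Finset.sum_le_sum key
  have hL : (den : ℝ) * ∑ w ∈ S, u w * ((∑ i ∈ Finset.range n, (m w - (((i + 1 : ℕ) : ℤ) + 1) * rout w -
        e w * ((f (i + 1) * m w - den * ((((i + 1 : ℕ) : ℤ)) * δ w + (((i + 1 : ℕ) : ℤ) + 1) * rin w)) / (den * e w))) : ℤ) : ℝ) =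
      ∑ w ∈ S, u w * ((den : ℝ) * ((∑ i ∈ Finset.range n, (m w - (((i + 1 : ℕ) : ℤ) + 1) * rout w -
        e w * ((f (i + 1) * m w - den * ((((i + 1 : ℕ) : ℤ)) * δ w + (((i + 1 : ℕ) : ℤ) + 1) * rin w)) / (den * e w))) : ℤ) : ℝ)) := by
    rw [Finset.mul_sum]; refine Finset.sum_congr rfl fun w _ => by ring
  have hR : ∑ w ∈ S, u w * ((den : ℝ) * (((∑ i ∈ Finset.range n, ((((i + 1 : ℕ) : ℤ)) * δ w + (((i + 1 : ℕ) : ℤ) + 1) * (rin w - rout w)) : ℤ) : ℝ)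
        + (n : ℝ) * (e w : ℝ)) - (m w : ℝ) * (demandSum f den n : ℝ)) =
      (den : ℝ) * ∑ w ∈ S, u w * (((∑ i ∈ Finset.range n, ((((i + 1 : ℕ) : ℤ)) * δ w + (((i + 1 : ℕ) : ℤ) + 1) * (rin w - rout w)) : ℤ) : ℝ)
        + (n : ℝ) * (e w : ℝ)) - (∑ w ∈ S, u w * (m w : ℝ)) * (demandSum f den n : ℝ) := by
    rw [Finset.mul_sum, Finset.sum_mul, ← Finset.sum_sub_distrib]; refine Finset.sum_congr rfl fun w _ => by ring
  have hden' : (0 : ℝ) < den := by exact_mod_cast hden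
  have h0 : 0 ≤ (den : ℝ) * ∑ w ∈ S, u w * ((∑ i ∈ Finset.range n, (m w - (((i + 1 : ℕ) : ℤ) + 1) * rout w -
        e w * ((f (i + 1) * m w - den * ((((i + 1 : ℕ) : ℤ)) * δ w + (((i + 1 : ℕ) : ℤ) + 1) * rin w)) / (den * e w))) : ℤ) : ℝ) :=
    mul_nonneg hden'.le h
  linarith [hL, hR, hsum, h0]

/-- **EXACT-SLACK («PARTIAL CREDIT») KEPT AMOUNT IS BELOW THE LAW-FREE BUDGET FOR EVERY ORDER**: the kept part of cell `j` in `den`-units is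
`min(demand, demand + den·margin_j) = min((f(j) − den)m, price_j)`, and `Σ_{j≤n} min(…) ≤ den·Π⁰ + n·den·e` whatever `m` and `f` are — recovered
fraction `≤ den(Π⁰ + n e)/(m·dS_f(n))`: EXPONENT `−1` in the order (height), the constant law-free over `dS_f(n)/den`. [folklore] -/
theorem keptSlack_le_budget {den e : ℤ} (hden : 0 < den) (he : 0 < e) (f : ℕ → ℤ) (m δ rin rout : ℤ) (n : ℕ) :
    ∑ i ∈ Finset.range n, min ((f (i + 1) - den) * m) ((f (i + 1) - den) * m + den * (m - (((i + 1 : ℕ) : ℤ) + 1) * rout -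
        e * ((f (i + 1) * m - den * ((((i + 1 : ℕ) : ℤ)) * δ + (((i + 1 : ℕ) : ℤ) + 1) * rin)) / (den * e)))) ≤
      den * ∑ i ∈ Finset.range n, ((((i + 1 : ℕ) : ℤ)) * δ + (((i + 1 : ℕ) : ℤ) + 1) * (rin - rout)) + (n : ℤ) * (den * e) := by
  have hconst : (n : ℤ) * (den * e) = ∑ _i ∈ Finset.range n, den * e := by simp
  rw [Finset.mul_sum, hconst, ← Finset.sum_add_distrib]
  refine Finset.sum_le_sum fun i _ => ?_
  have h := (den_mul_margin_bracket hden he f m δ rin rout (i + 1)).2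
  exact (min_le_right _ _).trans (by linarith)

/-- **SHARP ∀-CAP FOR LAWS WITH `f(1) = den`** (the «∀-CERT» constant kind of RULING R82 (a), `C₁`-shape): label `1` keeps `min(0, price₁) ≤ 0` and every
integer residue is `≤ den·e − 1`, so for `n ≥ 1` labels `Σ_{j≤n} min(demand_j, price_j) ≤ den·(Π⁰ − (δ + 2G)) + (n−1)(den·e − 1)` — for EVERY order `m`:
`s·μ_L1,f(s) ≤ den·Σ_w u_w[Σ_{j≥2}(jD_w+(j+1)G_w) + (n−1)(e_w − 1/den)]/(dS_f(n)·Σ_w u_w m_q(w))` at every height. [folklore] -/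
theorem keptSlack_le_budget_of_at_one {den e : ℤ} (hden : 0 < den) (he : 0 < e) {f : ℕ → ℤ} (hf1 : f 1 = den) (m δ rin rout : ℤ)
    {n : ℕ} (hn : 1 ≤ n) :
    ∑ i ∈ Finset.range n, min ((f (i + 1) - den) * m) ((f (i + 1) - den) * m + den * (m - (((i + 1 : ℕ) : ℤ) + 1) * rout -
        e * ((f (i + 1) * m - den * ((((i + 1 : ℕ) : ℤ)) * δ + (((i + 1 : ℕ) : ℤ) + 1) * rin)) / (den * e)))) ≤
      den * ∑ i ∈ Finset.range n, ((((i + 1 : ℕ) : ℤ)) * δ + (((i + 1 : ℕ) : ℤ) + 1) * (rin - rout))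
        - den * (δ + 2 * (rin - rout)) + ((n : ℤ) - 1) * (den * e - 1) := by
  obtain ⟨k, rfl⟩ : ∃ k, n = k + 1 := ⟨n - 1, by omega⟩
  rw [Finset.sum_range_succ', Finset.sum_range_succ']
  have h0 : min ((f (0 + 1) - den) * m) ((f (0 + 1) - den) * m + den * (m - (((0 + 1 : ℕ) : ℤ) + 1) * rout -
        e * ((f (0 + 1) * m - den * ((((0 + 1 : ℕ) : ℤ)) * δ + (((0 + 1 : ℕ) : ℤ) + 1) * rin)) / (den * e)))) ≤ 0 := by
    refine (min_le_left _ _).trans ?_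
    rw [zero_add, hf1, sub_self, zero_mul]
  have hP0 : (((0 + 1 : ℕ) : ℤ)) * δ + (((0 + 1 : ℕ) : ℤ) + 1) * (rin - rout) = δ + 2 * (rin - rout) := by push_cast; ring
  have hterm : ∀ i ∈ Finset.range k,
      min ((f (i + 1 + 1) - den) * m) ((f (i + 1 + 1) - den) * m + den * (m - (((i + 1 + 1 : ℕ) : ℤ) + 1) * rout -
        e * ((f (i + 1 + 1) * m - den * ((((i + 1 + 1 : ℕ) : ℤ)) * δ + (((i + 1 + 1 : ℕ) : ℤ) + 1) * rin)) / (den * e)))) ≤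
      den * ((((i + 1 + 1 : ℕ) : ℤ)) * δ + (((i + 1 + 1 : ℕ) : ℤ) + 1) * (rin - rout)) + (den * e - 1) := by
    intro i _
    refine (min_le_right _ _).trans ?_
    rw [den_mul_margin_eq]
    have h1 : (f (i + 1 + 1) * m - den * ((((i + 1 + 1 : ℕ) : ℤ)) * δ + (((i + 1 + 1 : ℕ) : ℤ) + 1) * rin)) % (den * e) < den * e :=
      Int.emod_lt_of_pos _ (mul_pos hden he)
    linarith
  have hsum := Finset.sum_le_sum hterm
  rw [Finset.sum_add_distrib, Finset.sum_const, Finset.card_range, nsmul_eq_mul, ← Finset.mul_sum] at hsum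
  rw [hP0]
  push_cast at hsum h0 ⊢
  linarith

/-! ## §3. The constants differ between laws by `l`-only factors `den·S(n)/dS_f(n)` -/

/-- **`κ = 1` MULTIPLIER `(2n+5)/3`**: `3·dS_{j²}(n) = (2n+5)·dS_{j}(n)`. [folklore] -/
theorem three_mul_demandSum_sq_eq (n : ℕ) :
    3 * demandSum (fun j => (j : ℤ) ^ 2) 1 n = (2 * (n : ℤ) + 5) * demandSum (fun j => (j : ℤ)) 1 n := by
  have h1 := six_mul_demandSum_sq n
  have h2 := two_mul_demandSum_id n
  have h : 2 * (3 * demandSum (fun j => (j : ℤ) ^ 2) 1 n) = 2 * ((2 * (n : ℤ) + 5) * demandSum (fun j => (j : ℤ)) 1 n) := by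
    linear_combination h1 - (2 * (n : ℤ) + 5) * h2
  exact mul_left_cancel₀ two_ne_zero h

/-- **SHIFT MULTIPLIER `(2n+5)/(2n+5+6a)`**: `(2n+5)·dS_{shift a}(n) = (2n+5+6a)·dS_{j²}(n)`. [folklore] -/
theorem demandSum_shift_mul (a n : ℕ) :
    (2 * (n : ℤ) + 5) * demandSum (lawShift a) 1 n = (2 * (n : ℤ) + 5 + 6 * a) * demandSum (fun j => (j : ℤ) ^ 2) 1 n := by
  have h1 := six_mul_demandSum_shift a n
  have h2 := six_mul_demandSum_sq n
  have h : 6 * ((2 * (n : ℤ) + 5) * demandSum (lawShift a) 1 n) = 6 * ((2 * (n : ℤ) + 5 + 6 * a) * demandSum (fun j => (j : ℤ) ^ 2) 1 n) := by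
    linear_combination (2 * (n : ℤ) + 5) * h1 - (2 * (n : ℤ) + 5 + 6 * (a : ℤ)) * h2
  exact mul_left_cancel₀ (by norm_num) h

/-- **HALF-INTEGER LAWS BRACKETED BY INTEGER ONES**: `dS_j ≤ dS_{⌈j^{3/2}⌉} ≤ dS_{j²} ≤ dS_{⌈j^{5/2}⌉}` — so the `κ = 3/2` multiplier lies in
`[1, (2n+5)/3]` and the `κ = 5/2` multiplier is `≤ 1` (p506542 `demandSum_halfInteger_bracket`, cited). [folklore] -/
theorem demandSum_multiplier_bracket (n : ℕ) :
    demandSum (fun j => (j : ℤ)) 1 n ≤ demandSum (lawPow 3) 1 n ∧ demandSum (lawPow 3) 1 n ≤ demandSum (fun j => (j : ℤ) ^ 2) 1 n ∧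
      demandSum (fun j => (j : ℤ) ^ 2) 1 n ≤ demandSum (lawPow 5) 1 n :=
  let h := demandSum_halfInteger_bracket n
  ⟨h.1, h.2.1, h.2.2.1⟩

/-- **CERTIFIED `κ = 3/2` LOWER BRACKET** on the multiplier `dS_{j²}/dS_{⌈j^{3/2}⌉}` (from p508156's majorant `2dS ≤ ⌈√n⌉n(n+1) − 2n`; `n ≥ 1`):
`(n−1)(2n+5)·dS_{⌈j^{3/2}⌉}(n) ≤ 3(⌈√n⌉(n+1) − 2)·dS_{j²}(n)`, i.e. multiplier `≥ (n−1)(2n+5)/(3(⌈√n⌉(n+1) − 2)) ≍ (2/3)√n`. [folklore] -/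
theorem demandSum_lawPow_three_multiplier_lb {n : ℕ} (hn : 1 ≤ n) :
    ((n : ℤ) - 1) * (2 * n + 5) * demandSum (lawPow 3) 1 n ≤ 3 * ((ceilSqrt n : ℤ) * (n + 1) - 2) * demandSum (fun j => (j : ℤ) ^ 2) 1 n := by
  have h1 := two_mul_demandSum_lawPow_three_le n
  have h2 := six_mul_demandSum_sq n
  have hn' : (1 : ℤ) ≤ n := by exact_mod_cast hn
  have hk : 0 ≤ ((n : ℤ) - 1) * (2 * n + 5) := mul_nonneg (by linarith) (by linarith)
  have h3 := mul_le_mul_of_nonneg_left h1 hk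
  have h4 : 6 * (3 * ((ceilSqrt n : ℤ) * (n + 1) - 2) * demandSum (fun j => (j : ℤ) ^ 2) 1 n) =
      3 * ((ceilSqrt n : ℤ) * (n + 1) - 2) * ((n : ℤ) * (n - 1) * (2 * n + 5)) := by rw [← h2]; ring
  have h5 : 6 * (((n : ℤ) - 1) * (2 * n + 5) * demandSum (lawPow 3) 1 n) ≤
      6 * (3 * ((ceilSqrt n : ℤ) * (n + 1) - 2) * demandSum (fun j => (j : ℤ) ^ 2) 1 n) := by
    rw [h4]
    have h6 : 6 * (((n : ℤ) - 1) * (2 * n + 5) * demandSum (lawPow 3) 1 n) =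
        3 * (((n : ℤ) - 1) * (2 * n + 5) * (2 * demandSum (lawPow 3) 1 n)) := by ring
    have h7 : 3 * (((n : ℤ) - 1) * (2 * n + 5) * ((ceilSqrt n : ℤ) * n * (n + 1) - 2 * n)) =
        3 * ((ceilSqrt n : ℤ) * (n + 1) - 2) * ((n : ℤ) * (n - 1) * (2 * n + 5)) := by ring
    rw [h6, ← h7]
    exact mul_le_mul_of_nonneg_left h3 (by norm_num)
  exact le_of_mul_le_mul_left h5 (by norm_num)

/-! ## §4. Worked place FREY `p = 7`, `l = 107` (`e 1605`, `m 210`, `δ 1604`, `r_in 268`, `r_out −4472`, `n = 53`) -/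

/-- PRINT EXTINCT from order `6345` on (`3·6345 = 19035 > 2·1604 + 3·4740 + 1605 = 19033`; `6345 = 30.2·m`), while at the bed `j₀ = 31`
(p506542 `worked_print`). [folklore] -/
theorem worked_print_extinct {m' : ℤ} (hm : 6345 ≤ m') {j : ℕ} (hj : 2 ≤ j) :
    ¬ Cell (fun j => (j : ℤ) ^ 2) 1 1605 m' 1604 268 (-4472) j :=
  not_cell_sq_of_lt (by norm_num) (by linarith) (by norm_num) (by norm_num) (by linarith) hj

/-- `κ = 1` EXTINCT from order `19034 = 90.6·m` on — while at the bed order `210` it licenses ALL `53` labels (p506542 `worked_kappaOne_all`):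
the STEP of the `κ = 1` licence tier at this place lies between `s = 30.2` (`(δ+G)/m`) and `s = 90.6`. [folklore] -/
theorem worked_kappaOne_extinct {m' : ℤ} (hm : 19034 ≤ m') {j : ℕ} (hj : 2 ≤ j) :
    ¬ Cell (fun j => (j : ℤ)) 1 1605 m' 1604 268 (-4472) j :=
  not_cell_id_of_lt (by norm_num) (by linarith) (by norm_num) (by norm_num) (by linarith) hj

/-- The place's LAW-FREE price sum: `Π⁰ = Σ_{j≤53}(1604j + 4740(j+1)) = 9,329,484`; with the floor term `Π⁰ + 53·1605 = 9,414,549`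
(the D-0121 worked-place integers of record bracket `Π = 9,374,578`, FINAL (1)(b)). [folklore] -/
theorem worked_priceSum :
    ∑ i ∈ Finset.range 53, ((((i + 1 : ℕ) : ℤ)) * 1604 + (((i + 1 : ℕ) : ℤ) + 1) * (268 - (-4472))) = 9329484 := by
  have h := two_mul_priceSum 1604 (268 - (-4472)) 53
  simp only [Nat.cast_ofNat] at h
  have h2 : (53 : ℤ) * (53 + 1) * 1604 + 53 * (53 + 3) * (268 - (-4472)) = 2 * 9329484 := by norm_num
  linarith

/-- Demand sums at `n = 53`: print `dS = 50,986` (`M_print = 210·50,986 = 10,707,060`, FINAL (1)(b)), `κ = 1` `dS = 1378` — multiplier `37 = (2·53+5)/3`. [folklore] -/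
theorem worked_demandSums :
    demandSum (fun j => (j : ℤ) ^ 2) 1 53 = 50986 ∧ demandSum (fun j => (j : ℤ)) 1 53 = 1378 := by
  have h1 := six_mul_demandSum_sq 53
  have h2 := two_mul_demandSum_id 53
  norm_num at h1 h2
  constructor <;> linarith

/-- **PRINT IS NETTED-NEGATIVE AT THE BED** at this place: `210·50,986 = 10,707,060 > 9,414,549 = Π⁰ + n·e` — so `Σ_j margin_j < 0` already at
order `210` (the Szpiro-bad place of the worked datum; the datum-level crossing `1.477` involves the other places). [folklore] -/
theorem worked_print_netted_neg :
    ∑ i ∈ Finset.range 53, ((210 : ℤ) - (((i + 1 : ℕ) : ℤ) + 1) * (-4472) -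
        1605 * (((fun j : ℕ => (j : ℤ) ^ 2) (i + 1) * 210 - 1 * ((((i + 1 : ℕ) : ℤ)) * 1604 + (((i + 1 : ℕ) : ℤ) + 1) * 268)) / (1 * 1605))) < 0 := by
  refine lt_of_not_ge fun hge => ?_
  have h := demand_le_of_netSlack_nonneg one_pos (by norm_num : (0 : ℤ) < 1605) (fun j : ℕ => (j : ℤ) ^ 2) 210 1604 268 (-4472) 53 hge
  rw [worked_priceSum, worked_demandSums.1] at h
  norm_num at h

/-- **`κ = 1` STAYS NETTED-NONNEGATIVE UP TO ORDER `6770 = 32.2·m`** at this place (`6770·1378 = 9,329,060 ≤ Π⁰`) … [folklore] -/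
theorem worked_kappaOne_netted_nonneg :
    0 ≤ ∑ i ∈ Finset.range 53, ((6770 : ℤ) - (((i + 1 : ℕ) : ℤ) + 1) * (-4472) -
        1605 * (((fun j : ℕ => (j : ℤ)) (i + 1) * 6770 - 1 * ((((i + 1 : ℕ) : ℤ)) * 1604 + (((i + 1 : ℕ) : ℤ) + 1) * 268)) / (1 * 1605))) := by
  refine netSlack_nonneg_of_demand_le one_pos (by norm_num : (0 : ℤ) < 1605) (fun j : ℕ => (j : ℤ)) 6770 1604 268 (-4472) 53 ?_
  rw [worked_priceSum, worked_demandSums.2]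
  norm_num

/-- … and is NETTED-NEGATIVE from order `6833 = 32.5·m` on (`6833·1378 = 9,415,874 > Π⁰ + n·e`): the `κ = 1` crossing at this place is `≈ 37×`
print's would-be crossing `Π/M ≈ 0.88` — the `(2n+5)/3` multiplier, nothing else. [folklore] -/
theorem worked_kappaOne_netted_neg {m' : ℤ} (hm : 6833 ≤ m') :
    ∑ i ∈ Finset.range 53, (m' - (((i + 1 : ℕ) : ℤ) + 1) * (-4472) -
        1605 * (((fun j : ℕ => (j : ℤ)) (i + 1) * m' - 1 * ((((i + 1 : ℕ) : ℤ)) * 1604 + (((i + 1 : ℕ) : ℤ) + 1) * 268)) / (1 * 1605))) < 0 := by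
  refine lt_of_not_ge fun hge => ?_
  have h := demand_le_of_netSlack_nonneg one_pos (by norm_num : (0 : ℤ) < 1605) (fun j : ℕ => (j : ℤ)) m' 1604 268 (-4472) 53 hge
  rw [worked_priceSum, worked_demandSums.2] at h
  norm_num at h
  linarith

end Summit.ABC.IUTFork.Repair.RH.ReqsideWeightLaws.HeightScaling
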